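import Summits.QuantumFields.YangMills.Theorems.UnitScaleTiltProp7GSerSecondDiff
import Summits.QuantumFields.YangMills.Theorems.UnitScaleTiltProp7GSerAdEquivariance
import HarnessLib

/-!
# Prop 7, route-R E′, (E1-c) brick F4b — THE RESUMMATION COEFFICIENT `ĉ_c(λ)Z := g(ad(c•λ))Z − Z`: THE FIVE HYPOTHESES OF F1's PRODUCT RULE, LOCALLY IN `‖λ‖ ≤ R₀`, PLUS ITS SECOND-DIFFERENCE ROW AND THE PINNED-CONE SIZE `2‖λ‖‖Z‖`

Route `UnitScaleTilt`, crux K1 child «MinimiserStabilityRegPr» (`stmt-QuantumFields-19200`), cell ym3-torus, width seat px15 (gen 2); pen «px15 g2: (E1-c) GO-LOCATE» (★p1 g15,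
2026-08-28T20:45:05Z), LOCATE `LOCATE-E1C-DIVLIPSCHITZ-px15g2.md` §6 (F4).  THEOREMS ONLY (0 `def`, 0 `sorry`); `--supports stmt-QuantumFields-19200`, count-neutral.
YM₃ on T³ is a ladder rung (R3), not the Clay problem; nothing here claims the stub, the crux, d = 4 or the mass gap.

WHY.  In F3c ✓p671341 the pure-gauge piece is `P₂ = ĉ_c(λ)(H) + 𝒩`, `ĉ_c(λ)Z := g(ad(c•λ))Z − Z` (`c = i`, `|c| ≤ 1`), and the linear term is resummed against `Δ_Wψ` by F1 ✓p669426
`divB_siteCoeff_eq_of_equivariant` ∕ `norm_divB_siteCoeff_le(_torus)`, whose hypotheses on the coefficient are: additivity (`hĉ`, `hĉsum`), conjugation-equivariance (`hequiv`), size `ν`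
(`hν`) and `λ`-Lipschitz `κ` (`hκ`).  Here they are discharged for `ĉ_c` — size and Lipschitz LOCALLY (`‖λ‖ ≤ R₀`; globally they are false, `g(ad λ)` grows like `e^{2‖λ‖}`), which is
what the contraction uses (`‖ψ‖ ≤ 3C_L s`); F4's copy of F1's three-line proof takes the local rows.  Beyond F1's list, the `hN` row (a second difference) needs the FOUR-POINT row of
`λ ↦ ĉ_c(λ)` (§3, from ✓p670255 `norm_gSer_secondDiff_le`), and the ρ₃-junction needs the pinned-cone size `‖ĉ_c(λ)Z‖ ≤ 2‖λ‖‖Z‖` (`‖λ‖ ≤ ½`; then `‖λ(x)‖ ≤ dist(x,C)·sup‖D_Wψ‖`).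

WHAT IS PROVED (any complete normed `ℂ`-algebra `E`, `c : ℂ`, `‖c‖ ≤ 1` where needed; ns `…Theorems.Prop7ResumCoeffRows`):
§1 `coeff_map_sub`, `coeff_map_sum` (F1's `hĉ`, `hĉsum`), ★ `coeff_equivariant` (F1's `hequiv`, units form `u(·)u⁻¹`, from F4a); §2 `ad_sub`, `norm_ad_smul_le`, ★ `norm_coeff_le`
(`ν(R₀) = (e^{2R₀} − 1)∕2`), ★★ `norm_coeff_le_two_mul` (pinned-cone size `2‖λ‖‖Z‖` for `‖λ‖ ≤ ½`), ★ `norm_coeff_sub_coeff_le` (`κ(R₀) = 2e^{2R₀}`); §3 ★★ `norm_coeff_secondDiff_apply_le`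
(`‖[(ĉ a − ĉ b) − (ĉ a′ − ĉ b′)]Z‖ ≤ 2e^{2R₀}(‖(a−b)−(a′−b′)‖ + 2‖a′−b′‖(‖a−a′‖+‖b−b′‖))‖Z‖`).  HONEST SCOPE.  Elementary ([folklore]).

References: T. Bałaban, CMP 98 (1985) 17–51 [Balaban1985Averaging] ((32)–(34) p.22); B. C. Hall, *Lie Groups, Lie Algebras, and Representations*, 2nd ed. (2015), Thm. 5.4 [Hall2015].
-/

set_option autoImplicit false

noncomputable section

open NormedSpace
open scoped Nat

namespace Summit.QuantumFields.YangMills.Theorems.Prop7ResumCoeffRows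

open Literature.Analysis.Calculus.ExpDifferential (gSer ad mulL mulR norm_ad_le norm_gSer_sub_one_le)
open Summit.QuantumFields.YangMills.Theorems.Prop7GSerSecondDiff (norm_gSer_sub_gSer_le norm_gSer_secondDiff_le)
open Summit.QuantumFields.YangMills.Theorems.Prop7GSerAdEquivariance (conj_gSerSubOne_apply conj_smul)

variable {E : Type*} [NormedRing E] [NormedAlgebra ℂ E] [CompleteSpace E]

/-! ## §1 Additivity and equivariance (F1's `hĉ`, `hĉsum`, `hequiv`) -/

omit [CompleteSpace E] in
/-- F1's `hĉ`: `ĉ(λ)(Z − Z′) = ĉ(λ)Z − ĉ(λ)Z′`. [folklore] -/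
theorem coeff_map_sub (c : ℂ) (lam Z Z' : E) :
    gSer ℂ (ad ℂ (c • lam)) (Z - Z') - (Z - Z') = (gSer ℂ (ad ℂ (c • lam)) Z - Z) - (gSer ℂ (ad ℂ (c • lam)) Z' - Z') := by
  rw [map_sub]
  abel

omit [CompleteSpace E] in
/-- F1's `hĉsum`: `ĉ(λ)(Σ f) = Σ ĉ(λ)(f μ)`. [folklore] -/
theorem coeff_map_sum {ι : Type*} (s : Finset ι) (c : ℂ) (lam : E) (f : ι → E) :
    gSer ℂ (ad ℂ (c • lam)) (∑ μ ∈ s, f μ) - ∑ μ ∈ s, f μ = ∑ μ ∈ s, (gSer ℂ (ad ℂ (c • lam)) (f μ) - f μ) := by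
  rw [map_sum, Finset.sum_sub_distrib]

/-- ★ F1's `hequiv` (units form): `u·ĉ(λ)Z·u⁻¹ = ĉ(uλu⁻¹)(uZu⁻¹)`. [cite: Balaban1985Averaging, (32)-(33) p.22] -/
theorem coeff_equivariant (u : Eˣ) (c : ℂ) (lam Z : E) :
    (u : E) * (gSer ℂ (ad ℂ (c • lam)) Z - Z) * (↑u⁻¹ : E)
      = gSer ℂ (ad ℂ (c • ((u : E) * lam * (↑u⁻¹ : E)))) ((u : E) * Z * (↑u⁻¹ : E)) - (u : E) * Z * (↑u⁻¹ : E) := by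
  rw [conj_gSerSubOne_apply, conj_smul]

/-! ## §2 Local size and Lipschitz rows (F1's `hν`, `hκ` on `‖λ‖ ≤ R₀`) -/

omit [CompleteSpace E] in
/-- `ad X − ad Y = ad(X − Y)`. [folklore] -/
theorem ad_sub (X Y : E) : ad ℂ X - ad ℂ Y = ad ℂ (X - Y) := by
  ext h
  simp only [ad, mulL, mulR, sub_apply, ContinuousLinearMap.mul_apply', ContinuousLinearMap.flip_apply]
  noncomm_ring

omit [CompleteSpace E] in
/-- `‖ad(c•λ)‖ ≤ 2‖λ‖` for `‖c‖ ≤ 1`. [folklore] -/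
theorem norm_ad_smul_le {c : ℂ} (hc : ‖c‖ ≤ 1) (lam : E) : ‖ad ℂ (c • lam)‖ ≤ 2 * ‖lam‖ := by
  refine (norm_ad_le (𝕂 := ℂ) (c • lam)).trans ?_
  rw [norm_smul]
  nlinarith [norm_nonneg lam, norm_nonneg c]

/-- ★ LOCAL SIZE (F1's `hν` on the ball): `‖λ‖ ≤ R₀` ⇒ `‖ĉ(λ)Z‖ ≤ (e^{2R₀} − 1)∕2·‖Z‖`. [cite: Balaban1985Averaging, (33) p.22] -/
theorem norm_coeff_le {c : ℂ} (hc : ‖c‖ ≤ 1) {lam : E} {R₀ : ℝ} (hlam : ‖lam‖ ≤ R₀) (Z : E) :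
    ‖gSer ℂ (ad ℂ (c • lam)) Z - Z‖ ≤ (Real.exp (2 * R₀) - 1) / 2 * ‖Z‖ := by
  have e : gSer ℂ (ad ℂ (c • lam)) Z - Z = (gSer ℂ (ad ℂ (c • lam)) - 1) Z := by
    rw [sub_apply, one_apply_eq_self]
  rw [e]
  refine (ContinuousLinearMap.le_opNorm _ _).trans (mul_le_mul_of_nonneg_right ?_ (norm_nonneg _))
  refine (norm_gSer_sub_one_le (𝕂 := ℂ) _).trans ?_
  have h : ‖ad ℂ (c • lam)‖ ≤ 2 * R₀ := (norm_ad_smul_le hc lam).trans (by linarith)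
  have := Real.exp_le_exp.2 h
  linarith

/-- ★★ PINNED-CONE SIZE: `‖λ‖ ≤ ½` ⇒ `‖ĉ(λ)Z‖ ≤ 2‖λ‖·‖Z‖` (`(e^{2r} − 1)∕2 ≤ 2r` on `[0, ½]`). [cite: Balaban1985Averaging, (33) p.22] -/
theorem norm_coeff_le_two_mul {c : ℂ} (hc : ‖c‖ ≤ 1) {lam : E} (hlam : ‖lam‖ ≤ 1 / 2) (Z : E) :
    ‖gSer ℂ (ad ℂ (c • lam)) Z - Z‖ ≤ 2 * ‖lam‖ * ‖Z‖ := by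
  refine (norm_coeff_le hc le_rfl Z).trans (mul_le_mul_of_nonneg_right ?_ (norm_nonneg _))
  set r := ‖lam‖ with hr
  have hr0 : 0 ≤ r := norm_nonneg _
  have h1 : |2 * r| ≤ 1 := by rw [abs_of_nonneg (by linarith)]; linarith
  have h2 := Real.abs_exp_sub_one_sub_id_le h1
  have h3 : Real.exp (2 * r) - 1 - 2 * r ≤ (2 * r) ^ 2 := (le_abs_self _).trans h2
  nlinarith

/-- ★ LOCAL LIPSCHITZ (F1's `hκ` on the ball): `‖λ‖,‖λ′‖ ≤ R₀` ⇒ `‖ĉ(λ)Z − ĉ(λ′)Z‖ ≤ 2e^{2R₀}·‖λ − λ′‖·‖Z‖`. [cite: Balaban1985Averaging, (33) p.22] -/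
theorem norm_coeff_sub_coeff_le {c : ℂ} (hc : ‖c‖ ≤ 1) {lam lam' : E} {R₀ : ℝ} (hlam : ‖lam‖ ≤ R₀) (hlam' : ‖lam'‖ ≤ R₀) (Z : E) :
    ‖(gSer ℂ (ad ℂ (c • lam)) Z - Z) - (gSer ℂ (ad ℂ (c • lam')) Z - Z)‖ ≤ 2 * Real.exp (2 * R₀) * ‖lam - lam'‖ * ‖Z‖ := by
  rw [sub_sub_sub_cancel_right, ← sub_apply]
  refine (ContinuousLinearMap.le_opNorm _ _).trans (mul_le_mul_of_nonneg_right ?_ (norm_nonneg _))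
  have ha : ‖ad ℂ (c • lam)‖ ≤ 2 * R₀ := (norm_ad_smul_le hc lam).trans (by linarith)
  have ha' : ‖ad ℂ (c • lam')‖ ≤ 2 * R₀ := (norm_ad_smul_le hc lam').trans (by linarith)
  refine (norm_gSer_sub_gSer_le ha ha').trans ?_
  rw [ad_sub, ← smul_sub]
  have h := norm_ad_smul_le hc (lam - lam')
  have h0 : 0 ≤ Real.exp (2 * R₀) := (Real.exp_pos _).le
  nlinarith [mul_le_mul_of_nonneg_left h h0]

/-! ## §3 The four-point row of `λ ↦ ĉ_c(λ)` (for the `hN` second difference) -/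

/-- ★★ SECOND DIFFERENCE of the coefficient: for `‖a‖,‖b‖,‖a′‖,‖b′‖ ≤ R₀`,
`‖[(ĉ a − ĉ b) − (ĉ a′ − ĉ b′)]Z‖ ≤ 2e^{2R₀}·(‖(a−b)−(a′−b′)‖ + 2‖a′−b′‖(‖a−a′‖ + ‖b−b′‖))·‖Z‖` (the `−Z` parts cancel). [cite: Balaban1985Averaging, (32)-(33) p.22] -/
theorem norm_coeff_secondDiff_apply_le {c : ℂ} (hc : ‖c‖ ≤ 1) {a b a' b' : E} {R₀ : ℝ}
    (ha : ‖a‖ ≤ R₀) (hb : ‖b‖ ≤ R₀) (ha' : ‖a'‖ ≤ R₀) (hb' : ‖b'‖ ≤ R₀) (Z : E) :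
    ‖((gSer ℂ (ad ℂ (c • a)) Z - Z) - (gSer ℂ (ad ℂ (c • b)) Z - Z))
        - ((gSer ℂ (ad ℂ (c • a')) Z - Z) - (gSer ℂ (ad ℂ (c • b')) Z - Z))‖
      ≤ 2 * Real.exp (2 * R₀) * (‖(a - b) - (a' - b')‖ + 2 * ‖a' - b'‖ * (‖a - a'‖ + ‖b - b'‖)) * ‖Z‖ := by
  have e : ((gSer ℂ (ad ℂ (c • a)) Z - Z) - (gSer ℂ (ad ℂ (c • b)) Z - Z))
        - ((gSer ℂ (ad ℂ (c • a')) Z - Z) - (gSer ℂ (ad ℂ (c • b')) Z - Z))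
      = ((gSer ℂ (ad ℂ (c • a)) - gSer ℂ (ad ℂ (c • b))) - (gSer ℂ (ad ℂ (c • a')) - gSer ℂ (ad ℂ (c • b')))) Z := by
    simp only [sub_apply]
    abel
  rw [e]
  refine (ContinuousLinearMap.le_opNorm _ _).trans (mul_le_mul_of_nonneg_right ?_ (norm_nonneg _))
  have hR : ∀ {x : E}, ‖x‖ ≤ R₀ → ‖ad ℂ (c • x)‖ ≤ 2 * R₀ := fun hx => (norm_ad_smul_le hc _).trans (by linarith)
  refine (norm_gSer_secondDiff_le (hR ha) (hR hb) (hR ha') (hR hb')).trans ?_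
  rw [ad_sub, ad_sub, ad_sub, ad_sub, ad_sub, ← smul_sub, ← smul_sub, ← smul_sub, ← smul_sub, ← smul_sub]
  have h1 := norm_ad_smul_le hc ((a - b) - (a' - b'))
  have h2 := norm_ad_smul_le hc (a' - b')
  have h3 := norm_ad_smul_le hc (a - a')
  have h4 := norm_ad_smul_le hc (b - b')
  have h0 : 0 ≤ Real.exp (2 * R₀) := (Real.exp_pos _).le
  have hs : ‖ad ℂ (c • (a - a'))‖ + ‖ad ℂ (c • (b - b'))‖ ≤ 2 * (‖a - a'‖ + ‖b - b'‖) := by linarith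
  have hprod : ‖ad ℂ (c • (a' - b'))‖ * (‖ad ℂ (c • (a - a'))‖ + ‖ad ℂ (c • (b - b'))‖) ≤ 2 * ‖a' - b'‖ * (2 * (‖a - a'‖ + ‖b - b'‖)) :=
    mul_le_mul h2 hs (by positivity) (by positivity)
  have hsum : ‖ad ℂ (c • (a - b - (a' - b')))‖ + ‖ad ℂ (c • (a' - b'))‖ * (‖ad ℂ (c • (a - a'))‖ + ‖ad ℂ (c • (b - b'))‖)
      ≤ 2 * (‖(a - b) - (a' - b')‖ + 2 * ‖a' - b'‖ * (‖a - a'‖ + ‖b - b'‖)) := by linarith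
  calc Real.exp (2 * R₀) * (‖ad ℂ (c • (a - b - (a' - b')))‖ + ‖ad ℂ (c • (a' - b'))‖ * (‖ad ℂ (c • (a - a'))‖ + ‖ad ℂ (c • (b - b'))‖))
      ≤ Real.exp (2 * R₀) * (2 * (‖(a - b) - (a' - b')‖ + 2 * ‖a' - b'‖ * (‖a - a'‖ + ‖b - b'‖))) := mul_le_mul_of_nonneg_left hsum h0
    _ = 2 * Real.exp (2 * R₀) * (‖(a - b) - (a' - b')‖ + 2 * ‖a' - b'‖ * (‖a - a'‖ + ‖b - b'‖)) := by ring

end Summit.QuantumFields.YangMills.Theorems.Prop7ResumCoeffRows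

end
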